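import Literature.AlgebraicGeometry.Resolution.ValuedFunctionFields
import Mathlib.RingTheory.AlgebraicIndependent.Basic
import Mathlib.LinearAlgebra.Dimension.Finite
import Mathlib.FieldTheory.IntermediateField.Basic
import HarnessLib

/-!
# Valuation independence (Knaf–Kuhlmann 2005, §2; Bourbaki, Alg. Comm. VI §10.3)

Topic: `Literature/AlgebraicGeometry/Resolution`. In the ambient rendering of
`ValuedFunctionFields.lean` (one valued field `(Ω, V)`, subfields `K ⊆ Ω`) we PROVE
Knaf–Kuhlmann 2005, Thm. 2.1 ("the value of a polynomial is the least of the values of its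
monomials" for elements `xᵢ` with values rationally independent over `vK` and `yⱼ` with residues
algebraically independent over `KP`) and its consequences: `x, y` are algebraically independent
over `K`, `vK(x, y) = vK ⊕ ⊕ ℤ vxᵢ`, `K(x, y)P = KP(yP)`; and the finiteness half of the
fundamental inequality for a finite extension `T|B` inside `(Ω, V)` (elements with values in
distinct cosets modulo `vB`, resp. with `BP`-linearly independent residues, are `B`-linearly
independent). These are the tools behind Knaf–Kuhlmann 2005, Cor. 2.2 (proved from them in
`FiniteExtensionUniformizationProofs.lean`) and Knaf–Kuhlmann 2009, Prop. 2.3.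

## Rendering

Polynomials in the `xᵢ` and `yⱼ` over the subfield `K` are iterated polynomials
`F ∈ (K[Y])[X] = MvPolynomial ι (MvPolynomial κ K)`, evaluated by
`MvPolynomial.eval₂ (MvPolynomial.aeval y) x`; `K[x, y]` (`Subring.closure`) is the set of their
values and `K(x, y)` (`Subfield.closure (K ∪ range x ∪ range y)`) the set of their quotients.
"Values `v(xᵢ)` rationally independent over `vK`" is `∏ v(xᵢ)^{mᵢ} ∈ vK ⇒ m = 0` (`m ∈ ℤ^ι`),
as in `IsAbhyankarPlace`; residues live in `IsLocalRing.ResidueField V`, `KP = resField V K`.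

## Source

* H. Knaf, F.-V. Kuhlmann, *Abhyankar places admit local uniformization in any characteristic*,
  Ann. Sci. ÉNS 38 (2005) 833–846 = arXiv:math/0304159, §2 "Valuation independence": Thm. 2.1
  and the fundamental inequality (2) (pp. 5–6 of the arXiv PDF; proof of Thm. 2.1: Bourbaki,
  *Algèbre commutative*, Ch. VI, §10.3, Thm. 1).
-/

noncomputable section

namespace Literature.AlgebraicGeometry.Resolution

universe u

open IsLocalRing MvPolynomial

variable {Ω : Type u} [Field Ω]

/-! ## Polynomials in residue-transcendental elements -/

section Residue

variable (V : ValuationSubring Ω) (K : Subfield Ω) {κ : Type*} (y : κ → Ω)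

/-- A monomial in elements of `V` lies in `V`. [folklore] -/
theorem prod_pow_mem (hy : ∀ j, y j ∈ V) (d : κ →₀ ℕ) : (∏ j ∈ d.support, y j ^ d j) ∈ V :=
  prod_mem fun j _ => pow_mem (hy j) _

/-- Elements of `K` of value at most that of `c ∈ K`, `c ≠ 0`, divided by `c`, lie in `V ∩ K`.
[folklore] -/
theorem div_mem_of_valuation_le {a c : Ω} (hc : c ≠ 0)
    (h : V.valuation a ≤ V.valuation c) : a / c ∈ V := by
  rw [← V.valuation_le_one_iff, map_div₀]
  have hc' : V.valuation c ≠ 0 := (map_ne_zero V.valuation).mpr hc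
  exact div_le_one_of_le₀ h zero_le

/-- **Knaf–Kuhlmann 2005, Thm. 2.1, residue part** (Bourbaki VI §10.3): if the residues of
`yⱼ ∈ V` are algebraically independent over `KP` and `g ∈ K[Y]` has all coefficients of value
`≤ v(c)` for a coefficient `c ≠ 0` of `g`, then `g(y) = c · h` with `h ∈ V` a unit of `V`; more
precisely the residue of `h` is the value at `yP` of a NON-ZERO polynomial over `KP`, namely the
reduction of `g / c`. [cite: KnafKuhlmann2005, Thm. 2.1] -/
theorem exists_unit_aeval_eq_mul (hy : ∀ j, y j ∈ V)
    (hri : AlgebraicIndependent (resField V K) (fun j => residue V ⟨y j, hy j⟩))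
    (g : MvPolynomial κ K) {d₀ : κ →₀ ℕ} (hd₀ : d₀ ∈ g.support)
    (hmax : ∀ d ∈ g.support, V.valuation ((g.coeff d : K) : Ω) ≤ V.valuation ((g.coeff d₀ : K) : Ω)) :
    ∃ (h : V) (gb : MvPolynomial κ (resField V K)), gb ≠ 0 ∧
      MvPolynomial.aeval y g = ((g.coeff d₀ : K) : Ω) * h ∧
      (residue V h : ResidueField V) = MvPolynomial.aeval (fun j => residue V ⟨y j, hy j⟩) gb ∧
      V.valuation (h : Ω) = 1 := by
  classical
  set c : Ω := ((g.coeff d₀ : K) : Ω) with hc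
  have hc0 : c ≠ 0 := by
    rw [hc]
    exact_mod_cast MvPolynomial.mem_support_iff.mp hd₀
  -- the normalised coefficients `g.coeff d / c ∈ V ∩ K`
  have hcoefV : ∀ d, ((g.coeff d : K) : Ω) / c ∈ V := by
    intro d
    by_cases hd : d ∈ g.support
    · exact div_mem_of_valuation_le V hc0 (hmax d hd)
    · have : g.coeff d = 0 := MvPolynomial.notMem_support_iff.mp hd
      simp [this]
  have hcoefK : ∀ d, ((g.coeff d : K) : Ω) / c ∈ K := fun d => div_mem (g.coeff d).2 (g.coeff d₀).2
  -- the reduced polynomial `gb`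
  let redc : (κ →₀ ℕ) → resField V K := fun d =>
    ⟨residue V ⟨((g.coeff d : K) : Ω) / c, hcoefV d⟩, residue_mem_resField V _ (hcoefK d)⟩
  let gb : MvPolynomial κ (resField V K) := ∑ d ∈ g.support, MvPolynomial.monomial d (redc d)
  -- the element `h := g(y) / c ∈ V`
  let hV : V := ∑ d ∈ g.support, ⟨((g.coeff d : K) : Ω) / c, hcoefV d⟩ * ⟨_, prod_pow_mem V y hy d⟩
  have hhV : (hV : Ω) = ∑ d ∈ g.support, ((g.coeff d : K) : Ω) / c * ∏ j ∈ d.support, y j ^ d j := by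
    simp [hV]
  have haeval : MvPolynomial.aeval y g = c * hV := by
    rw [MvPolynomial.aeval_def, MvPolynomial.eval₂_eq, hhV, Finset.mul_sum]
    refine Finset.sum_congr rfl fun d _ => ?_
    rw [← mul_assoc, mul_div_cancel₀ _ hc0]
    rfl
  -- the residue of `h` is `gb(yP)`
  have hres : (residue V hV : ResidueField V) =
      MvPolynomial.aeval (fun j => residue V ⟨y j, hy j⟩) gb := by
    simp only [hV, gb, map_sum, map_mul, MvPolynomial.aeval_monomial]
    refine Finset.sum_congr rfl fun d _ => ?_
    congr 1
    rw [Finsupp.prod]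
    have : (⟨∏ j ∈ d.support, y j ^ d j, prod_pow_mem V y hy d⟩ : V) =
        ∏ j ∈ d.support, (⟨y j, hy j⟩ : V) ^ d j := by
      apply Subtype.ext
      simp
    rw [this, map_prod]
    simp only [map_pow]
  -- `gb ≠ 0`: its coefficient at `d₀` is `1`
  have hgb0 : gb ≠ 0 := by
    intro h0
    have h1 : gb.coeff d₀ = 1 := by
      simp only [gb, MvPolynomial.coeff_sum, MvPolynomial.coeff_monomial, Finset.sum_ite_eq',
        if_pos hd₀]
      apply Subtype.ext
      change residue V ⟨((g.coeff d₀ : K) : Ω) / c, _⟩ = 1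
      have : (⟨((g.coeff d₀ : K) : Ω) / c, hcoefV d₀⟩ : V) = 1 := Subtype.ext (div_self hc0)
      rw [this, map_one]
    rw [h0, MvPolynomial.coeff_zero] at h1
    exact zero_ne_one h1
  -- hence `residue h ≠ 0`, i.e. `h` is a unit of `V`
  have hres0 : residue V hV ≠ 0 := by
    rw [hres]
    exact fun h0 => hgb0 (hri.eq_zero_of_aeval_eq_zero gb h0)
  have hunit : V.valuation (hV : Ω) = 1 := by
    refine (V.valuation_eq_one_iff hV).mp ?_
    by_contra hnu
    exact hres0 ((residue_eq_zero_iff hV).mpr ((IsLocalRing.mem_maximalIdeal hV).mpr hnu))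
  exact ⟨hV, gb, hgb0, haeval, hres, hunit⟩

end Residue

/-! ## Polynomials in value-independent and residue-transcendental elements -/

section Main

variable (V : ValuationSubring Ω) (K : Subfield Ω) {ι κ : Type*} (x : ι → Ω) (y : κ → Ω)

/-- The evaluation `F(x, y) = ∑ₑ F_e(y) xᵉ` of an iterated polynomial `F ∈ (K[Y])[X]`.
[folklore] -/
theorem eval₂_aeval_eq [Fintype ι] (F : MvPolynomial ι (MvPolynomial κ K)) :
    MvPolynomial.eval₂ (MvPolynomial.aeval y).toRingHom x F =
      ∑ e ∈ F.support, MvPolynomial.aeval y (F.coeff e) * ∏ i, x i ^ e i :=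
  MvPolynomial.eval₂_eq' _ _ _

/-- **Knaf–Kuhlmann 2005, Thm. 2.1** (Bourbaki VI §10.3, Thm. 1), dominant term: let the
values `v(xᵢ)`, `xᵢ ≠ 0`, be ℤ-independent modulo `vK` and the residues of the `yⱼ ∈ V`
algebraically independent over `KP`. For a non-zero `F = ∑ₑ F_e(Y) Xᵉ ∈ (K[Y])[X]` there are a
term `e₀` and a coefficient `c₀ ≠ 0` of `F_{e₀}` such that `v(c xᵉ) ≤ v(c₀ x^{e₀})` for every
monomial `c Yᵈ Xᵉ` of `F`, and `F(x, y) = c₀ · h · x^{e₀} · (1 + ε)` with `h ∈ V` a unit whose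
residue is `ḡ(yP)` for a non-zero `ḡ ∈ KP[Y]` and `v(ε) < 1`; in particular
`v(F(x, y)) = v(c₀) · v(x^{e₀})` is the maximum of the values of the monomials of `F` ("the value
of a polynomial is the least of the values of its monomials"). [cite: KnafKuhlmann2005,
Thm. 2.1] -/
theorem exists_dominant_term [Fintype ι] (hx0 : ∀ i, x i ≠ 0)
    (hxi : ∀ m : ι → ℤ, (∃ b ∈ K, (∏ i, V.valuation (x i) ^ (m i)) = V.valuation b) → m = 0)
    (hy : ∀ j, y j ∈ V)
    (hri : AlgebraicIndependent (resField V K) (fun j => residue V ⟨y j, hy j⟩))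
    (F : MvPolynomial ι (MvPolynomial κ K)) (hF : F ≠ 0) :
    ∃ e₀ ∈ F.support, ∃ d₀ ∈ (F.coeff e₀).support,
      (∀ e ∈ F.support, ∀ d ∈ (F.coeff e).support,
        V.valuation (((F.coeff e).coeff d : K) : Ω) * ∏ i, V.valuation (x i) ^ (e i) ≤
          V.valuation (((F.coeff e₀).coeff d₀ : K) : Ω) * ∏ i, V.valuation (x i) ^ (e₀ i)) ∧
      ∃ (h : V) (gb : MvPolynomial κ (resField V K)) (ε : Ω), gb ≠ 0 ∧
        V.valuation (h : Ω) = 1 ∧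
        (residue V h : ResidueField V) = MvPolynomial.aeval (fun j => residue V ⟨y j, hy j⟩) gb ∧
        V.valuation ε < 1 ∧
        MvPolynomial.eval₂ (MvPolynomial.aeval y).toRingHom x F =
          (((F.coeff e₀).coeff d₀ : K) : Ω) * h * (∏ i, x i ^ e₀ i) * (1 + ε) := by
  classical
  -- the dominant coefficient `d e` of each `F_e`, and the resulting values `w e`
  have hsuppne : ∀ e ∈ F.support, (F.coeff e).support.Nonempty := fun e he =>
    MvPolynomial.support_nonempty.mpr (MvPolynomial.mem_support_iff.mp he)
  have hdom : ∀ e ∈ F.support, ∃ d ∈ (F.coeff e).support, ∀ d' ∈ (F.coeff e).support,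
      V.valuation (((F.coeff e).coeff d' : K) : Ω) ≤ V.valuation (((F.coeff e).coeff d : K) : Ω) :=
    fun e he => Finset.exists_max_image _ _ (hsuppne e he)
  choose d hd hdmax using hdom
  -- Step A for each `F_e`
  have hA : ∀ e (he : e ∈ F.support), ∃ (h : V) (gb : MvPolynomial κ (resField V K)), gb ≠ 0 ∧
      MvPolynomial.aeval y (F.coeff e) = (((F.coeff e).coeff (d e he) : K) : Ω) * h ∧
      (residue V h : ResidueField V) = MvPolynomial.aeval (fun j => residue V ⟨y j, hy j⟩) gb ∧
      V.valuation (h : Ω) = 1 :=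
    fun e he => exists_unit_aeval_eq_mul V K y hy hri (F.coeff e) (hd e he) (hdmax e he)
  choose hh gb hgb0 haev hres hunit using hA
  -- the values `w e := v(c_e) · v(x^e)` of the terms, `c_e` the dominant coefficient of `F_e`
  let c : ∀ e, e ∈ F.support → Ω := fun e he => (((F.coeff e).coeff (d e he) : K) : Ω)
  have hc0 : ∀ e he, c e he ≠ 0 := fun e he => by
    change (((F.coeff e).coeff (d e he) : K) : Ω) ≠ 0
    exact_mod_cast MvPolynomial.mem_support_iff.mp (hd e he)
  have hcK : ∀ e he, c e he ∈ K := fun e he => ((F.coeff e).coeff (d e he)).2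
  let xpow : (ι →₀ ℕ) → Ω := fun e => ∏ i, x i ^ e i
  have hxpow0 : ∀ e, xpow e ≠ 0 := fun e => Finset.prod_ne_zero_iff.mpr fun i _ => pow_ne_zero _ (hx0 i)
  have hvxpow : ∀ e, V.valuation (xpow e) = ∏ i, V.valuation (x i) ^ (e i) := fun e => by
    simp [xpow, map_prod, map_pow]
  let w : (ι →₀ ℕ) → V.ValueGroup := fun e =>
    if he : e ∈ F.support then V.valuation (c e he) * ∏ i, V.valuation (x i) ^ (e i) else 0
  have hw : ∀ e (he : e ∈ F.support), w e = V.valuation (c e he) * ∏ i, V.valuation (x i) ^ (e i) :=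
    fun e he => dif_pos he
  -- the terms `t e := F_e(y) x^e` have value `w e`
  let t : (ι →₀ ℕ) → Ω := fun e => MvPolynomial.aeval y (F.coeff e) * xpow e
  have hvt : ∀ e (he : e ∈ F.support), V.valuation (t e) = w e := by
    intro e he
    rw [hw e he]
    change V.valuation (MvPolynomial.aeval y (F.coeff e) * xpow e) = _
    rw [map_mul, haev e he, map_mul, hunit e he, mul_one, hvxpow]
  -- distinct terms have distinct values (ℤ-independence of the `v(xᵢ)` modulo `vK`)
  have hvx0 : ∀ i, V.valuation (x i) ≠ 0 := fun i => (map_ne_zero V.valuation).mpr (hx0 i)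
  have hwinj : ∀ e (he : e ∈ F.support) e' (he' : e' ∈ F.support), w e = w e' → e = e' := by
    intro e he e' he' hee'
    rw [hw e he, hw e' he'] at hee'
    have hm := hxi (fun i => (e i : ℤ) - e' i) ⟨c e' he' / c e he, div_mem (hcK e' he') (hcK e he), ?_⟩
    · ext i
      have := congr_fun hm i
      simp only [Pi.zero_apply, sub_eq_zero, Nat.cast_inj] at this
      exact this
    · rw [map_div₀, eq_div_iff ((map_ne_zero V.valuation).mpr (hc0 e he))]
      have h1 : (∏ i, V.valuation (x i) ^ ((e i : ℤ) - e' i)) =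
          (∏ i, V.valuation (x i) ^ (e i)) / ∏ i, V.valuation (x i) ^ (e' i) := by
        rw [← Finset.prod_div_distrib]
        refine Finset.prod_congr rfl fun i _ => ?_
        rw [zpow_sub₀ (hvx0 i), zpow_natCast, zpow_natCast]
      rw [h1, div_mul_eq_mul_div, div_eq_iff (Finset.prod_ne_zero_iff.mpr fun i _ =>
        pow_ne_zero _ (hvx0 i)), mul_comm, ← hee', mul_comm]
  -- the dominant term `e₀`
  obtain ⟨e₀, he₀, he₀max⟩ := Finset.exists_max_image F.support w (MvPolynomial.support_nonempty.mpr hF)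
  have hlt : ∀ e ∈ F.support \ {e₀}, V.valuation (t e) < V.valuation (t e₀) := by
    intro e he
    obtain ⟨heF, hne⟩ := Finset.mem_sdiff.mp he
    rw [Finset.mem_singleton] at hne
    rw [hvt e heF, hvt e₀ he₀]
    exact lt_of_le_of_ne (he₀max e heF) fun hEq => hne (hwinj e heF e₀ he₀ hEq)
  have ht₀0 : t e₀ ≠ 0 := by
    intro h0
    have := hvt e₀ he₀
    rw [h0, map_zero, hw e₀ he₀] at this
    exact (mul_ne_zero ((map_ne_zero V.valuation).mpr (hc0 e₀ he₀))
      (Finset.prod_ne_zero_iff.mpr fun i _ => pow_ne_zero _ (hvx0 i))) this.symm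
  -- `F(x, y) = t e₀ · (1 + ε)`
  have hsum : MvPolynomial.eval₂ (MvPolynomial.aeval y).toRingHom x F = ∑ e ∈ F.support, t e :=
    eval₂_aeval_eq K x y F
  let ε : Ω := (∑ e ∈ F.support \ {e₀}, t e) / t e₀
  have hvε : V.valuation ε < 1 := by
    change V.valuation ((∑ e ∈ F.support \ {e₀}, t e) / t e₀) < 1
    rw [map_div₀, div_lt_one₀ (lt_of_le_of_ne zero_le ((map_ne_zero V.valuation).mpr ht₀0).symm)]
    exact Valuation.map_sum_lt _ ((map_ne_zero V.valuation).mpr ht₀0) hlt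
  have hdecomp : ∑ e ∈ F.support, t e = t e₀ * (1 + ε) := by
    rw [← Finset.add_sum_erase _ _ he₀, Finset.erase_eq, mul_add, mul_one, mul_div_cancel₀ _ ht₀0]
  refine ⟨e₀, he₀, d e₀ he₀, hd e₀ he₀, ?_, hh e₀ he₀, gb e₀ he₀, ε, hgb0 e₀ he₀, hunit e₀ he₀,
    hres e₀ he₀, hvε, ?_⟩
  · -- maximality over all monomials
    intro e he d' hd'
    calc V.valuation (((F.coeff e).coeff d' : K) : Ω) * ∏ i, V.valuation (x i) ^ (e i)
        ≤ V.valuation (c e he) * ∏ i, V.valuation (x i) ^ (e i) :=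
          mul_le_mul_left (hdmax e he d' hd') _
      _ = w e := (hw e he).symm
      _ ≤ w e₀ := he₀max e he
      _ = _ := hw e₀ he₀
  · rw [hsum, hdecomp]
    change MvPolynomial.aeval y (F.coeff e₀) * xpow e₀ * (1 + ε) = _
    rw [haev e₀ he₀]

/-! ### Consequences: algebraic independence, value group and residue field of `K(x, y)` -/

/-- `K[x, y]` (the subring of `Ω` generated by `K`, the `xᵢ` and the `yⱼ`) consists of the
values `F(x, y)` of iterated polynomials `F ∈ (K[Y])[X]`. [folklore] -/
theorem exists_eval₂_eq_of_mem_closure {a : Ω}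
    (ha : a ∈ Subring.closure ((K : Set Ω) ∪ (Set.range x ∪ Set.range y))) :
    ∃ F : MvPolynomial ι (MvPolynomial κ K),
      MvPolynomial.eval₂Hom (MvPolynomial.aeval y).toRingHom x F = a := by
  induction ha using Subring.closure_induction with
  | mem a h =>
    rcases h with ha | ⟨i, rfl⟩ | ⟨j, rfl⟩
    · refine ⟨MvPolynomial.C (MvPolynomial.C ⟨a, ha⟩), ?_⟩
      rw [MvPolynomial.eval₂Hom_C]
      change MvPolynomial.aeval y (MvPolynomial.C (⟨a, ha⟩ : K)) = a
      rw [MvPolynomial.algHom_C]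
      rfl
    · exact ⟨MvPolynomial.X i, MvPolynomial.eval₂Hom_X' _ _ i⟩
    · refine ⟨MvPolynomial.C (MvPolynomial.X j), ?_⟩
      rw [MvPolynomial.eval₂Hom_C]
      change MvPolynomial.aeval y (MvPolynomial.X j : MvPolynomial κ K) = y j
      exact MvPolynomial.aeval_X y j
  | zero => exact ⟨0, map_zero _⟩
  | one => exact ⟨1, map_one _⟩
  | add a b _ _ ha hb =>
    obtain ⟨F, rfl⟩ := ha
    obtain ⟨G, rfl⟩ := hb
    exact ⟨F + G, map_add _ _ _⟩
  | neg a _ ha =>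
    obtain ⟨F, rfl⟩ := ha
    exact ⟨-F, map_neg _ _⟩
  | mul a b _ _ ha hb =>
    obtain ⟨F, rfl⟩ := ha
    obtain ⟨G, rfl⟩ := hb
    exact ⟨F * G, map_mul _ _ _⟩

/-- Elements of `K(x, y)` are quotients `F(x, y) / G(x, y)` of values of iterated polynomials.
[folklore] -/
theorem exists_eval₂_div_eq {a : Ω}
    (ha : a ∈ Subfield.closure ((K : Set Ω) ∪ (Set.range x ∪ Set.range y))) :
    ∃ F G : MvPolynomial ι (MvPolynomial κ K),
      a = MvPolynomial.eval₂ (MvPolynomial.aeval y).toRingHom x F /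
        MvPolynomial.eval₂ (MvPolynomial.aeval y).toRingHom x G := by
  obtain ⟨p, hp, q, hq, rfl⟩ := Subfield.mem_closure_iff.mp ha
  obtain ⟨F, rfl⟩ := exists_eval₂_eq_of_mem_closure K x y hp
  obtain ⟨G, rfl⟩ := exists_eval₂_eq_of_mem_closure K x y hq
  exact ⟨F, G, rfl⟩

variable {x y}

/-- **Knaf–Kuhlmann 2005, Thm. 2.1**: `x, y` as in `exists_dominant_term` are algebraically
independent over `K` (in the iterated form: `F(x, y) = 0` only for `F = 0`).
[cite: KnafKuhlmann2005, Thm. 2.1] -/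
theorem eval₂_eq_zero_imp [Fintype ι] (hx0 : ∀ i, x i ≠ 0)
    (hxi : ∀ m : ι → ℤ, (∃ b ∈ K, (∏ i, V.valuation (x i) ^ (m i)) = V.valuation b) → m = 0)
    (hy : ∀ j, y j ∈ V)
    (hri : AlgebraicIndependent (resField V K) (fun j => residue V ⟨y j, hy j⟩))
    (F : MvPolynomial ι (MvPolynomial κ K))
    (hF0 : MvPolynomial.eval₂ (MvPolynomial.aeval y).toRingHom x F = 0) : F = 0 := by
  by_contra hF
  obtain ⟨e₀, he₀, d₀, hd₀, -, h, gb, ε, -, hvh, -, hvε, hdec⟩ :=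
    exists_dominant_term V K x y hx0 hxi hy hri F hF
  rw [hdec] at hF0
  have hc0 : (((F.coeff e₀).coeff d₀ : K) : Ω) ≠ 0 := by
    exact_mod_cast MvPolynomial.mem_support_iff.mp hd₀
  have hh0 : (h : Ω) ≠ 0 := fun h0 => by simp [h0] at hvh
  have hx : (∏ i, x i ^ e₀ i) ≠ 0 := Finset.prod_ne_zero_iff.mpr fun i _ => pow_ne_zero _ (hx0 i)
  have hε : (1 + ε) ≠ 0 := fun h0 => by
    have := V.valuation.map_one_add_of_lt hvε
    rw [h0, map_zero] at this
    exact zero_ne_one this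
  exact (mul_ne_zero (mul_ne_zero (mul_ne_zero hc0 hh0) hx) hε) hF0

/-- **Knaf–Kuhlmann 2005, Thm. 2.1, value group**: `vK(x, y) = vK ⊕ ⊕ᵢ ℤ v(xᵢ)` — every
non-zero element of `K(x, y)` has value `v(b) · ∏ v(xᵢ)^{mᵢ}` with `b ∈ K`, `m ∈ ℤ^ι`.
[cite: KnafKuhlmann2005, Thm. 2.1] -/
theorem exists_valuation_eq_of_mem_closure [Fintype ι] (hx0 : ∀ i, x i ≠ 0)
    (hxi : ∀ m : ι → ℤ, (∃ b ∈ K, (∏ i, V.valuation (x i) ^ (m i)) = V.valuation b) → m = 0)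
    (hy : ∀ j, y j ∈ V)
    (hri : AlgebraicIndependent (resField V K) (fun j => residue V ⟨y j, hy j⟩))
    {a : Ω} (ha : a ∈ Subfield.closure ((K : Set Ω) ∪ (Set.range x ∪ Set.range y)))
    (ha0 : a ≠ 0) :
    ∃ (m : ι → ℤ), ∃ b ∈ K,
      V.valuation a = V.valuation b * ∏ i, V.valuation (x i) ^ (m i) := by
  obtain ⟨F, G, rfl⟩ := exists_eval₂_div_eq K x y ha
  have hF : F ≠ 0 := by rintro rfl; simp at ha0
  have hG : G ≠ 0 := by rintro rfl; simp at ha0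
  obtain ⟨e₀, he₀, d₀, hd₀, -, h, -, ε, -, hvh, -, hvε, hdec⟩ :=
    exists_dominant_term V K x y hx0 hxi hy hri F hF
  obtain ⟨e₁, he₁, d₁, hd₁, -, h', -, ε', -, hvh', -, hvε', hdec'⟩ :=
    exists_dominant_term V K x y hx0 hxi hy hri G hG
  have hvx0 : ∀ i, V.valuation (x i) ≠ 0 := fun i => (map_ne_zero V.valuation).mpr (hx0 i)
  refine ⟨fun i => (e₀ i : ℤ) - e₁ i,
    (((F.coeff e₀).coeff d₀ : K) : Ω) / (((G.coeff e₁).coeff d₁ : K) : Ω),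
    div_mem ((F.coeff e₀).coeff d₀).2 ((G.coeff e₁).coeff d₁).2, ?_⟩
  rw [hdec, hdec']
  simp only [map_div₀, map_mul, map_prod, map_pow, hvh, hvh', V.valuation.map_one_add_of_lt hvε,
    V.valuation.map_one_add_of_lt hvε', mul_one]
  have h1 : (∏ i, V.valuation (x i) ^ ((e₀ i : ℤ) - e₁ i)) =
      (∏ i, V.valuation (x i) ^ (e₀ i)) / ∏ i, V.valuation (x i) ^ (e₁ i) := by
    rw [← Finset.prod_div_distrib]
    refine Finset.prod_congr rfl fun i _ => ?_
    rw [zpow_sub₀ (hvx0 i), zpow_natCast, zpow_natCast]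
  rw [h1, div_mul_div_comm]

/-- Values of polynomials over `KP` at the residues `yⱼP` lie in `KP(yP)`. [folklore] -/
theorem aeval_mem_closure {k : Subfield (ResidueField V)} (r : κ → ResidueField V)
    (gb : MvPolynomial κ k) :
    MvPolynomial.aeval r gb ∈ Subfield.closure ((k : Set (ResidueField V)) ∪ Set.range r) := by
  rw [MvPolynomial.aeval_def, MvPolynomial.eval₂_eq]
  refine Subfield.sum_mem _ fun d _ => Subfield.mul_mem _ ?_ ?_
  · exact Subfield.subset_closure (Or.inl (gb.coeff d).2)
  · refine prod_mem fun j _ => pow_mem ?_ _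
    exact Subfield.subset_closure (Or.inr ⟨j, rfl⟩)

/-- The inverse of a unit of `V`, computed in `Ω`. [folklore] -/
theorem coe_unit_inv (u : Vˣ) : (((u⁻¹ : Vˣ) : V) : Ω) = (((u : Vˣ) : V) : Ω)⁻¹ := by
  apply eq_inv_of_mul_eq_one_left
  rw [← V.coe_mul, Units.inv_mul, V.coe_one]

/-- An element `q` of `Ω` with `v(q - 1) < 1` lies in `V` and has residue `1`. [folklore] -/
theorem residue_eq_one_of_valuation_sub_one_lt {q : Ω} (hq : V.valuation (q - 1) < 1) :
    ∃ hqV : q ∈ V, residue V ⟨q, hqV⟩ = 1 := by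
  have hq1V : q - 1 ∈ V := (V.valuation_le_one_iff _).mp hq.le
  have hqV : q ∈ V := by
    have : q = (q - 1) + 1 := by ring
    rw [this]
    exact add_mem hq1V (one_mem V)
  refine ⟨hqV, ?_⟩
  have hmax : (⟨q - 1, hq1V⟩ : V) ∈ IsLocalRing.maximalIdeal V :=
    (V.valuation_lt_one_iff _).mpr hq
  have h0 : residue V ⟨q - 1, hq1V⟩ = 0 := (residue_eq_zero_iff _).mpr hmax
  have : (⟨q, hqV⟩ : V) = ⟨q - 1, hq1V⟩ + 1 := Subtype.ext (by simp)
  rw [this, map_add, map_one, h0, zero_add]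

/-- **Knaf–Kuhlmann 2005, Thm. 2.1, residue field**: `K(x, y)P = KP(yP)` — the residue of an
element of `V ∩ K(x, y)` lies in the subfield generated by `KP` and the residues `yⱼP`.
[cite: KnafKuhlmann2005, Thm. 2.1] -/
theorem residue_mem_closure_of_mem_closure [Fintype ι] (hx0 : ∀ i, x i ≠ 0)
    (hxi : ∀ m : ι → ℤ, (∃ b ∈ K, (∏ i, V.valuation (x i) ^ (m i)) = V.valuation b) → m = 0)
    (hy : ∀ j, y j ∈ V)
    (hri : AlgebraicIndependent (resField V K) (fun j => residue V ⟨y j, hy j⟩))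
    {a : Ω} (ha : a ∈ Subfield.closure ((K : Set Ω) ∪ (Set.range x ∪ Set.range y)))
    (haV : a ∈ V) :
    residue V ⟨a, haV⟩ ∈ Subfield.closure ((resField V K : Set (ResidueField V)) ∪
      Set.range (fun j => residue V ⟨y j, hy j⟩)) := by
  classical
  set kP := Subfield.closure ((resField V K : Set (ResidueField V)) ∪
      Set.range (fun j => residue V ⟨y j, hy j⟩)) with hkP
  by_cases ha0 : a = 0
  · subst ha0
    have : (⟨(0 : Ω), haV⟩ : V) = 0 := rfl
    rw [this, map_zero]
    exact zero_mem _
  -- if `v(a) < 1` the residue vanishes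
  by_cases hva : V.valuation a < 1
  · have : residue V ⟨a, haV⟩ = 0 :=
      (residue_eq_zero_iff _).mpr ((V.valuation_lt_one_iff _).mpr hva)
    rw [this]
    exact zero_mem _
  have hva1 : V.valuation a = 1 := le_antisymm ((V.valuation_le_one_iff a).mpr haV) (not_lt.mp hva)
  -- write `a = F(x,y) / G(x,y)` and take dominant terms
  obtain ⟨F, G, haFG⟩ := exists_eval₂_div_eq K x y ha
  have hF : F ≠ 0 := by rintro rfl; simp [haFG] at ha0
  have hG : G ≠ 0 := by rintro rfl; simp [haFG] at ha0
  obtain ⟨e₀, he₀, d₀, hd₀, -, h, gb, ε, -, hvh, hres, hvε, hdec⟩ :=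
    exists_dominant_term V K x y hx0 hxi hy hri F hF
  obtain ⟨e₁, he₁, d₁, hd₁, -, h', gb', ε', -, hvh', hres', hvε', hdec'⟩ :=
    exists_dominant_term V K x y hx0 hxi hy hri G hG
  set c₀ : Ω := (((F.coeff e₀).coeff d₀ : K) : Ω) with hc₀
  set c₁ : Ω := (((G.coeff e₁).coeff d₁ : K) : Ω) with hc₁
  have hc₀0 : c₀ ≠ 0 := by rw [hc₀]; exact_mod_cast MvPolynomial.mem_support_iff.mp hd₀
  have hc₁0 : c₁ ≠ 0 := by rw [hc₁]; exact_mod_cast MvPolynomial.mem_support_iff.mp hd₁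
  have hc₀K : c₀ ∈ K := ((F.coeff e₀).coeff d₀).2
  have hc₁K : c₁ ∈ K := ((G.coeff e₁).coeff d₁).2
  have hvx0 : ∀ i, V.valuation (x i) ≠ 0 := fun i => (map_ne_zero V.valuation).mpr (hx0 i)
  have hh'0 : (h' : Ω) ≠ 0 := fun h0 => by simp [h0] at hvh'
  have hε'0 : (1 + ε') ≠ 0 := fun h0 => by
    have := V.valuation.map_one_add_of_lt hvε'
    rw [h0, map_zero] at this
    exact zero_ne_one this
  have hε1 : V.valuation (1 + ε) = 1 := V.valuation.map_one_add_of_lt hvε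
  have hε'1 : V.valuation (1 + ε') = 1 := V.valuation.map_one_add_of_lt hvε'
  -- `v(a) = 1` forces `e₀ = e₁` and `v(c₀) = v(c₁)`
  have hva' : V.valuation a = V.valuation c₀ / V.valuation c₁ *
      ((∏ i, V.valuation (x i) ^ (e₀ i)) / ∏ i, V.valuation (x i) ^ (e₁ i)) := by
    rw [haFG, hdec, hdec']
    simp only [map_div₀, map_mul, map_prod, map_pow, hvh, hvh', hε1, hε'1, mul_one]
    rw [div_mul_div_comm]
  have he : e₀ = e₁ := by
    have hm := hxi (fun i => (e₀ i : ℤ) - e₁ i) ⟨c₁ / c₀, div_mem hc₁K hc₀K, ?_⟩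
    · ext i
      have := congr_fun hm i
      simp only [Pi.zero_apply, sub_eq_zero, Nat.cast_inj] at this
      exact this
    · have h1 : (∏ i, V.valuation (x i) ^ ((e₀ i : ℤ) - e₁ i)) =
          (∏ i, V.valuation (x i) ^ (e₀ i)) / ∏ i, V.valuation (x i) ^ (e₁ i) := by
        rw [← Finset.prod_div_distrib]
        refine Finset.prod_congr rfl fun i _ => ?_
        rw [zpow_sub₀ (hvx0 i), zpow_natCast, zpow_natCast]
      rw [h1, map_div₀]
      have hvc₀ : V.valuation c₀ ≠ 0 := (map_ne_zero V.valuation).mpr hc₀0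
      have hvc₁ : V.valuation c₁ ≠ 0 := (map_ne_zero V.valuation).mpr hc₁0
      rw [hva1] at hva'
      field_simp at hva' ⊢
      rw [hva']
  subst he
  have hX0 : (∏ i, x i ^ e₀ i) ≠ 0 := Finset.prod_ne_zero_iff.mpr fun i _ => pow_ne_zero _ (hx0 i)
  -- the three unit factors of `a`
  have hq : V.valuation ((1 + ε) / (1 + ε') - 1) < 1 := by
    have : (1 + ε) / (1 + ε') - 1 = (ε - ε') / (1 + ε') := by field_simp; ring
    rw [this, map_div₀, hε'1, div_one]
    exact lt_of_le_of_lt (V.valuation.map_sub _ _) (max_lt hvε hvε')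
  obtain ⟨hqV, hresq⟩ := residue_eq_one_of_valuation_sub_one_lt V hq
  have hu₁v : V.valuation (c₀ / c₁) = 1 := by
    rw [div_self (Finset.prod_ne_zero_iff.mpr fun i _ => pow_ne_zero _ (hvx0 i)), mul_one,
      hva1] at hva'
    rw [map_div₀]
    exact hva'.symm
  have hu₁V : c₀ / c₁ ∈ V := (V.valuation_le_one_iff _).mp hu₁v.le
  have hh'unit : IsUnit h' := (V.valuation_eq_one_iff h').mpr hvh'
  let w : V := h * ((hh'unit.unit⁻¹ : Vˣ) : V)
  have hw : (w : Ω) = h / h' := by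
    change ((h : Ω) * (((hh'unit.unit⁻¹ : Vˣ) : V) : Ω)) = h / h'
    rw [coe_unit_inv, IsUnit.unit_spec, div_eq_mul_inv]
  have hfac : (⟨a, haV⟩ : V) = ⟨c₀ / c₁, hu₁V⟩ * w * ⟨(1 + ε) / (1 + ε'), hqV⟩ := by
    apply Subtype.ext
    change a = c₀ / c₁ * (w : Ω) * ((1 + ε) / (1 + ε'))
    rw [hw, haFG, hdec, hdec']
    field_simp
  rw [hfac, map_mul, map_mul, hresq, mul_one]
  refine Subfield.mul_mem _ ?_ ?_
  · exact Subfield.subset_closure (Or.inl (residue_mem_resField V _ (div_mem hc₀K hc₁K)))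
  · change residue V (h * ((hh'unit.unit⁻¹ : Vˣ) : V)) ∈ kP
    rw [map_mul, map_units_inv]
    refine Subfield.mul_mem _ ?_ (Subfield.inv_mem _ ?_)
    · rw [hres]; exact aeval_mem_closure V _ gb
    · rw [IsUnit.unit_spec, hres']; exact aeval_mem_closure V _ gb'

end Main

/-! ## The fundamental inequality: finiteness of `vF/vF₀` and `[FP : F₀P]` for finite `F|F₀` -/

section FundamentalInequality

variable (V : ValuationSubring Ω) {B : Subfield Ω} (T : IntermediateField B Ω)

/-- Coercion to `Ω` of a `B`-linear combination in an intermediate field. [folklore] -/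
theorem coe_sum_smul {ι : Type*} (s : Finset ι) (g : ι → B) (a : ι → Ω) (haT : ∀ i, a i ∈ T) :
    ((∑ j ∈ s, g j • (⟨a j, haT j⟩ : T) : T) : Ω) = ∑ j ∈ s, (g j : Ω) * a j := by
  rw [AddSubmonoidClass.coe_finsetSum]
  refine Finset.sum_congr rfl fun j _ => ?_
  rw [IntermediateField.coe_smul]
  rfl

/-- **Fundamental inequality, value part** (e.g. Knaf–Kuhlmann 2005, (2) p. 6): elements of a
finite extension `T|B` inside `(Ω, V)` whose values lie in pairwise distinct cosets modulo `vB`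
are `B`-linearly independent; hence there are at most `[T : B]` of them. [folklore] -/
theorem card_le_finrank_of_valuation_ne [FiniteDimensional B T] {ι : Type*} [Fintype ι]
    (a : ι → Ω) (haT : ∀ i, a i ∈ T) (ha0 : ∀ i, a i ≠ 0)
    (hdist : ∀ i j, i ≠ j → ∀ c ∈ B, ∀ c' ∈ B, c ≠ 0 → c' ≠ 0 →
      V.valuation (c * a i) ≠ V.valuation (c' * a j)) :
    Fintype.card ι ≤ Module.finrank B T := by
  classical
  have hli : LinearIndependent B (fun i => (⟨a i, haT i⟩ : T)) := by
    rw [linearIndependent_iff']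
    intro s g hsum i hi
    by_contra hgi
    let s' : Finset ι := s.filter fun j => g j ≠ 0
    have hi' : i ∈ s' := Finset.mem_filter.mpr ⟨hi, hgi⟩
    have hsumΩ : ∑ j ∈ s', (g j : Ω) * a j = 0 := by
      have h1 : ∑ j ∈ s, (g j : Ω) * a j = 0 := by
        rw [← coe_sum_smul T s g a haT, hsum]
        rfl
      have h2 : ∑ j ∈ s', (g j : Ω) * a j = ∑ j ∈ s, (g j : Ω) * a j := by
        rw [Finset.sum_filter]
        refine Finset.sum_congr rfl fun j _ => ?_
        by_cases hj : g j ≠ 0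
        · rw [if_pos hj]
        · rw [if_neg hj]
          have hj0 : g j = 0 := not_not.mp hj
          simp [hj0]
      rw [h2, h1]
    obtain ⟨j₀, hj₀, hmax⟩ :=
      Finset.exists_max_image s' (fun j => V.valuation ((g j : Ω) * a j)) ⟨i, hi'⟩
    have hg0 : ∀ j ∈ s', (g j : Ω) ≠ 0 := fun j hj => by
      have := (Finset.mem_filter.mp hj).2
      exact_mod_cast this
    have hlt : ∀ j ∈ s' \ {j₀}, V.valuation ((g j : Ω) * a j) < V.valuation ((g j₀ : Ω) * a j₀) := by
      intro j hj
      obtain ⟨hjs', hne⟩ := Finset.mem_sdiff.mp hj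
      rw [Finset.mem_singleton] at hne
      exact lt_of_le_of_ne (hmax j hjs')
        (hdist j j₀ hne _ (g j).2 _ (g j₀).2 (hg0 j hjs') (hg0 j₀ hj₀))
    have hv := V.valuation.map_sum_eq_of_lt hj₀ hlt
    rw [hsumΩ, map_zero] at hv
    exact (mul_ne_zero (hg0 j₀ hj₀) (ha0 j₀)) ((map_eq_zero V.valuation).mp hv.symm)
  exact hli.fintype_card_le_finrank

/-- **Fundamental inequality, residue part** (e.g. Knaf–Kuhlmann 2005, (2) p. 6): elements of
`V ∩ T` whose residues are linearly independent over the residue field `BP` are `B`-linearly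
independent; hence there are at most `[T : B]` of them. [folklore] -/
theorem card_le_finrank_of_residue_linearIndependent [FiniteDimensional B T] {ι : Type*}
    [Fintype ι] (a : ι → Ω) (haT : ∀ i, a i ∈ T) (haV : ∀ i, a i ∈ V)
    (hres : LinearIndependent (resField V B) (fun i => residue V ⟨a i, haV i⟩)) :
    Fintype.card ι ≤ Module.finrank B T := by
  classical
  have hli : LinearIndependent B (fun i => (⟨a i, haT i⟩ : T)) := by
    rw [linearIndependent_iff']
    intro s g hsum
    by_contra hne
    obtain ⟨i, hi, hgi⟩ : ∃ i ∈ s, g i ≠ 0 := by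
      by_contra h'
      exact hne fun i hi => not_not.mp fun hgi => h' ⟨i, hi, hgi⟩
    obtain ⟨j₀, hj₀, hmax⟩ := Finset.exists_max_image s (fun j => V.valuation (g j : Ω)) ⟨i, hi⟩
    set c : Ω := (g j₀ : Ω) with hc
    have hc0 : c ≠ 0 := by
      intro h0
      have h1 : V.valuation (g i : Ω) ≤ V.valuation c := hmax i hi
      rw [h0, map_zero, le_zero_iff, map_eq_zero] at h1
      exact hgi (Subtype.ext h1)
    have hcB : c ∈ B := (g j₀).2
    have hgV : ∀ j ∈ s, (g j : Ω) / c ∈ V := fun j hj => div_mem_of_valuation_le V hc0 (hmax j hj)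
    -- the normalised relation, in `V`, and its reduction
    have hsumΩ : ∑ j ∈ s, (g j : Ω) / c * a j = 0 := by
      have h1 : ∑ j ∈ s, (g j : Ω) * a j = 0 := by
        rw [← coe_sum_smul T s g a haT, hsum]
        rfl
      have : ∑ j ∈ s, (g j : Ω) / c * a j = (∑ j ∈ s, (g j : Ω) * a j) / c := by
        rw [div_eq_mul_inv, Finset.sum_mul]
        exact Finset.sum_congr rfl fun j _ => by ring
      rw [this, h1, zero_div]
    let r : ι → resField V B := fun j =>
      if hj : j ∈ s then ⟨residue V ⟨(g j : Ω) / c, hgV j hj⟩,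
        residue_mem_resField V _ (div_mem (g j).2 hcB)⟩ else 0
    have hrel : ∑ j ∈ s, r j • residue V ⟨a j, haV j⟩ = 0 := by
      have hV : (∑ j ∈ s.attach, (⟨(g j : Ω) / c, hgV j j.2⟩ : V) * ⟨a j, haV j⟩) = 0 := by
        apply Subtype.ext
        rw [AddSubmonoidClass.coe_finsetSum]
        change ∑ j ∈ s.attach, (g j : Ω) / c * a j = 0
        rw [Finset.sum_attach s fun j => (g j : Ω) / c * a j]
        exact hsumΩ
      have := congrArg (residue V) hV
      rw [map_sum, map_zero] at this
      rw [← Finset.sum_attach, ← this]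
      refine Finset.sum_congr rfl fun j _ => ?_
      simp only [r, dif_pos j.2, map_mul, Subfield.smul_def, smul_eq_mul]
    have hr0 := (linearIndependent_iff'.mp hres) s r hrel j₀ hj₀
    have hr1 : r j₀ = 1 := by
      simp only [r, dif_pos hj₀]
      apply Subtype.ext
      change residue V ⟨(g j₀ : Ω) / c, _⟩ = 1
      have : (⟨(g j₀ : Ω) / c, hgV j₀ hj₀⟩ : V) = 1 := Subtype.ext (div_self hc0)
      rw [this, map_one]
    rw [hr1] at hr0
    exact one_ne_zero hr0
  exact hli.fintype_card_le_finrank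

end FundamentalInequality

end Literature.AlgebraicGeometry.Resolution

end
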